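import Literature.AlgebraicGeometry.Motives.MixedHodgeExtensionCongruence
import Literature.AlgebraicGeometry.Motives.MixedHodgeStructureAbelian
import Literature.AlgebraicGeometry.HodgeTheory.SecondaryPeriodOfPair
import HarnessLib

/-!
# Morphisms of extensions of mixed Hodge structures and the functoriality of Carlson's class

Continuation of `MixedHodgeExtension.lean` / `MixedHodgeExtensionCarlson.lean` /
`MixedHodgeExtensionCongruence.lean`. Carlson, *Extensions of mixed Hodge structures* (Journées de
géométrie algébrique d'Angers 1979), §2(b): "A *morphism* of extensions is a commutative diagram of
morphisms" `(α, φ, β)` between two exact sequences `0 → A → H → B → 0`, `0 → A' → H' → B' → 0`;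
PROPOSITION 1: "`Ext(*, *)` is a functor, contravariant in the first variable, and covariant in the
second"; PROPOSITION 2: for separated `A`, `B` "there is a canonical and functorial isomorphism
`Ext(B, A) ≅ J⁰Hom(B, A)`". In the tree's conventions (`Extension A B VE` is
`0 → B —inc→ E —proj→ A → 0`, class `Extension.cls ∈ JHom A B = Hom_ℂ(A_ℂ, B_ℂ)/(F⁰Hom + Hom_ℚ)`)
this file proves the **functoriality of the class** in the following sharp form: for every morphism
of extensions `(β : B → B', φ : E → E', α : A → A')` from `E` (of `A` by `B`) to `E'` (of `A'` by
`B'`),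

  `β_* [E] = α^* [E']` in `J⁰Hom(A, B')`   (`Morphism.postcomp_cls_eq_precomp_cls`),

where `β_* [ψ] = [β_ℂ ∘ ψ]` (`JHom.postcomp`, new) and `α^* [ψ'] = [ψ' ∘ α_ℂ]` (`JHom.precomp`,
`HodgeTheory/SecondaryPeriodOfPair`). The proof is Carlson's Lemma 4 argument run through `φ`: two
Hodge lifts `φ_ℂ ∘ s_F`, `s'_F ∘ α_ℂ` of `α_ℂ` into `E'_ℂ` differ by `i'_ℂ` of an element of
`F⁰Hom(A, B')` (strictness of `i'`), two rational lifts by `i'` of a rational map. Consequences: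
the class of an extension receiving a morphism over `(id_B, ·, α)` is the pulled-back class
(`cls_eq_precomp_cls`; e.g. the fibre product `E ×_A A'`, `MixedHodgeExtensionPullback.lean`), the
class of an extension emitting one under `(β, ·, id_A)` is the pushed-out class
(`cls_eq_postcomp_cls`), and morphisms over `(id, ·, id)` preserve the class (`cls_eq_cls`) — they are
in fact congruences: the short five lemma `Morphism.bijective_mid` and `Morphism.toCongruence`
(Carlson: "An isomorphism for which `α` and `β` are each the identity is called a *congruence*").
No separation hypothesis is needed anywhere in this file.

## Main definitions and results (all proved; no named facts)

* `JHom.postcomp A g : JHom A B →ₗ[ℚ] JHom A B'` for `g : Hom B B'`; `postcomp_mk`; the bifunctor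
  identities `precomp_id`, `postcomp_id`, `precomp_comp`, `postcomp_comp`, `precomp_comp_postcomp`.
* `Extension.Morphism E E'` — morphisms of extensions (`left = β`, `mid = φ`, `right = α`);
  `Morphism.id`, `Morphism.comp`, `Congruence.toMorphism`; `Morphism.injective_mid`,
  `Morphism.surjective_mid`, `Morphism.bijective_mid` (short five lemma); `Morphism.toCongruence`.
* `Morphism.postcomp_cls_eq_precomp_cls` — **`β_* [E] = α^* [E']`**; `Morphism.cls_eq_postcomp_cls`,
  `Morphism.cls_eq_precomp_cls`, `Morphism.cls_eq_cls`.

## References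

* [Carlson1980] J. A. Carlson, Extensions of mixed Hodge structures, Journées de géométrie
  algébrique d'Angers 1979, Sijthoff & Noordhoff (1980), 107–127: §2(b) (morphisms of extensions,
  congruences, Prop. 1, Prop. 2 "canonical and functorial"), §2(d) Lemma 4 (held text:
  `book:beauvillend-proceedings-indo-french-conference-geometry`, PDF pp. 88–90).
* [MacLane1963Homology] S. Mac Lane, Homology, Springer (1963): Ch. I Lemma 3.1 (short five lemma),
  Ch. III §1 (morphisms of extensions, congruence, `Eγ`, `αE`, Prop. 1.8 `αE ≡ E'γ`), §2 Thm. 2.1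
  (Carlson's reference [4] for Prop. 1; held text `book:mac-lane1963-homology`, PDF pp. 26, 83–90).
* [CattaniElZeinGriffithsLe2014] E. Cattani et al. (eds.), Hodge Theory (2014), Thm. 8.4.2 and
  Remark p. 380 (the class `v_ℤ - v_F` modulo `L_ℤ + F⁰L_ℂ`).
-/

open scoped TensorProduct

noncomputable section

namespace Literature.AlgebraicGeometry.Motives

namespace MixedHodgeStructure

universe u v w u' v' w'

variable {VA : Type u} [AddCommGroup VA] [Module ℚ VA]
variable {VB : Type v} [AddCommGroup VB] [Module ℚ VB]
variable {VE : Type w} [AddCommGroup VE] [Module ℚ VE]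
variable {VA' : Type u'} [AddCommGroup VA'] [Module ℚ VA']
variable {VB' : Type v'} [AddCommGroup VB'] [Module ℚ VB']
variable {VE' : Type w'} [AddCommGroup VE'] [Module ℚ VE']

/-! ### Functoriality of Carlson's Jacobian `J⁰Hom(A, B)` in both variables -/

namespace JHom

/-- **Push-forward of Carlson's Jacobian along a morphism** `g : B → B'` of mixed Hodge structures:
`J⁰Hom(A, B) → J⁰Hom(A, B')`, `[φ] ↦ [g_ℂ ∘ φ]` (well defined: `g_ℂ` respects `F`, so
`g_ℂ ∘ F⁰Hom(A, B) ⊆ F⁰Hom(A, B')`, and `(g ⊗ 1) ∘ (h ⊗ 1) = (g ∘ h) ⊗ 1`). Under `Ext ≅ J⁰Hom` this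
is the covariant functoriality of `Ext(*, *)` in the sub (Carlson 1980, Prop. 1–2).
[cite: Carlson1980, §2(b) Prop. 2] -/
def postcomp (A : MixedHodgeStructure VA) {B : MixedHodgeStructure VB} {B' : MixedHodgeStructure VB'}
    (g : Hom B B') : JHom A B →ₗ[ℚ] JHom A B' :=
  (JHomSub A B).liftQ
    (JHom.mk A B' ∘ₗ
      { toFun := fun φ => g.toLinearMap.baseChange ℂ ∘ₗ φ
        map_add' := fun _ _ => LinearMap.comp_add _ _ _
        map_smul' := fun c φ => LinearMap.ext fun x => by
          simp only [LinearMap.comp_apply, LinearMap.smul_apply, RingHom.id_apply,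
            LinearMap.map_smul_of_tower] }) (by
    refine sup_le ?_ ?_
    · intro φ hφ
      have hφ' : φ ∈ homF A B 0 := hφ
      refine (Submodule.Quotient.mk_eq_zero _).2 (Submodule.mem_sup_left ?_)
      change g.toLinearMap.baseChange ℂ ∘ₗ φ ∈ homF A B' 0
      rw [mem_homF_zero_iff] at hφ' ⊢
      intro q
      rw [Submodule.map_comp]
      exact (Submodule.map_mono (hφ' q)).trans (g.map_F_le q)
    · rintro _ ⟨h, rfl⟩
      refine (Submodule.Quotient.mk_eq_zero _).2 (Submodule.mem_sup_right ?_)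
      change g.toLinearMap.baseChange ℂ ∘ₗ h.baseChange ℂ ∈ ratHom VA VB'
      rw [← LinearMap.baseChange_comp]
      exact baseChange_mem_ratHom _)

/-- `postcomp g [φ] = [g_ℂ ∘ φ]`. [cite: Carlson1980, §2(b) Prop. 2] -/
@[simp]
theorem postcomp_mk (A : MixedHodgeStructure VA) {B : MixedHodgeStructure VB}
    {B' : MixedHodgeStructure VB'} (g : Hom B B') (φ : ℂ ⊗[ℚ] VA →ₗ[ℂ] ℂ ⊗[ℚ] VB) :
    postcomp A g (JHom.mk A B φ) = JHom.mk A B' (g.toLinearMap.baseChange ℂ ∘ₗ φ) := rfl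

/-- `id_* = id` on `J⁰Hom(A, B)`. [cite: Carlson1980, §2(b) Prop. 1] -/
theorem postcomp_id (A : MixedHodgeStructure VA) (B : MixedHodgeStructure VB) :
    postcomp A (Hom.id B) = LinearMap.id := by
  refine Submodule.linearMap_qext _ (LinearMap.ext fun φ => ?_)
  change postcomp A (Hom.id B) (JHom.mk A B φ) = JHom.mk A B φ
  rw [postcomp_mk, Hom.id_toLinearMap, LinearMap.baseChange_id, LinearMap.id_comp]

/-- `id^* = id` on `J⁰Hom(A, B)`. [cite: Carlson1980, §2(b) Prop. 1] -/
theorem precomp_id (A : MixedHodgeStructure VA) (B : MixedHodgeStructure VB) :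
    precomp A B (Hom.id A) = LinearMap.id := by
  refine Submodule.linearMap_qext _ (LinearMap.ext fun φ => ?_)
  change precomp A B (Hom.id A) (JHom.mk A B φ) = JHom.mk A B φ
  rw [precomp_mk, Hom.id_toLinearMap, LinearMap.baseChange_id, LinearMap.comp_id]

/-- `(g' ∘ g)_* = g'_* ∘ g_*` (covariance in the sub). [cite: Carlson1980, §2(b) Prop. 1] -/
theorem postcomp_comp (A : MixedHodgeStructure VA) {B : MixedHodgeStructure VB}
    {B' : MixedHodgeStructure VB'} {VB'' : Type*} [AddCommGroup VB''] [Module ℚ VB'']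
    {B'' : MixedHodgeStructure VB''} (g' : Hom B' B'') (g : Hom B B') :
    postcomp A (g'.comp g) = postcomp A g' ∘ₗ postcomp A g := by
  refine Submodule.linearMap_qext _ (LinearMap.ext fun φ => ?_)
  change postcomp A (g'.comp g) (JHom.mk A B φ) = postcomp A g' (postcomp A g (JHom.mk A B φ))
  rw [postcomp_mk, postcomp_mk, postcomp_mk, Hom.comp_toLinearMap, LinearMap.baseChange_comp,
    LinearMap.comp_assoc]

/-- `(f ∘ f')^* = f'^* ∘ f^*` (contravariance in the quotient). [cite: Carlson1980, §2(b) Prop. 1] -/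
theorem precomp_comp {A : MixedHodgeStructure VA} (B : MixedHodgeStructure VB)
    {A' : MixedHodgeStructure VA'} {VA'' : Type*} [AddCommGroup VA''] [Module ℚ VA'']
    {A'' : MixedHodgeStructure VA''} (f : Hom A' A) (f' : Hom A'' A') :
    precomp A B (f.comp f') = precomp A' B f' ∘ₗ precomp A B f := by
  refine Submodule.linearMap_qext _ (LinearMap.ext fun φ => ?_)
  change precomp A B (f.comp f') (JHom.mk A B φ) = precomp A' B f' (precomp A B f (JHom.mk A B φ))
  rw [precomp_mk, precomp_mk, precomp_mk, Hom.comp_toLinearMap, LinearMap.baseChange_comp,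
    LinearMap.comp_assoc]

/-- `f^* ∘ g_* = g_* ∘ f^*`: `J⁰Hom(*, *)` (hence `Ext(*, *)`) is a bifunctor.
[cite: Carlson1980, §2(b) Prop. 1] -/
theorem precomp_comp_postcomp {A : MixedHodgeStructure VA} {B : MixedHodgeStructure VB}
    {A' : MixedHodgeStructure VA'} {B' : MixedHodgeStructure VB'} (f : Hom A' A) (g : Hom B B') :
    precomp A B' f ∘ₗ postcomp A g = postcomp A' g ∘ₗ precomp A B f := by
  refine Submodule.linearMap_qext _ (LinearMap.ext fun φ => ?_)
  change precomp A B' f (postcomp A g (JHom.mk A B φ)) = postcomp A' g (precomp A B f (JHom.mk A B φ))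
  rw [postcomp_mk, precomp_mk, precomp_mk, postcomp_mk, LinearMap.comp_assoc]

end JHom

/-! ### Morphisms of extensions -/

namespace Extension

variable {A : MixedHodgeStructure VA} {B : MixedHodgeStructure VB}
variable {A' : MixedHodgeStructure VA'} {B' : MixedHodgeStructure VB'}

/-- A **morphism of extensions** (Carlson 1980, §2(b): "a commutative diagram of morphisms") from
`0 → B → E → A → 0` to `0 → B' → E' → A' → 0`: morphisms of mixed Hodge structures
`left = β : B → B'`, `mid = φ : E → E'`, `right = α : A → A'` with `φ ∘ i = i' ∘ β` and
`π' ∘ φ = α ∘ π`. [cite: Carlson1980, §2(b)] -/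
structure Morphism (E : Extension A B VE) (E' : Extension A' B' VE') where
  /-- The morphism on the subs, `β : B → B'`. -/
  left : Hom B B'
  /-- The morphism on the middle terms, `φ : E → E'`. -/
  mid : Hom E.mhs E'.mhs
  /-- The morphism on the quotients, `α : A → A'`. -/
  right : Hom A A'
  /-- The left square commutes: `φ ∘ i = i' ∘ β`. -/
  mid_inc : mid.toLinearMap ∘ₗ E.inc.toLinearMap = E'.inc.toLinearMap ∘ₗ left.toLinearMap
  /-- The right square commutes: `π' ∘ φ = α ∘ π`. -/
  proj_mid : E'.proj.toLinearMap ∘ₗ mid.toLinearMap = right.toLinearMap ∘ₗ E.proj.toLinearMap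

namespace Morphism

variable {E : Extension A B VE} {E' : Extension A' B' VE'}

/-- `φ (i b) = i' (β b)`. [cite: Carlson1980, §2(b)] -/
@[simp]
theorem mid_inc_apply (m : Morphism E E') (b : VB) :
    m.mid.toLinearMap (E.inc.toLinearMap b) = E'.inc.toLinearMap (m.left.toLinearMap b) :=
  LinearMap.congr_fun m.mid_inc b

/-- `π' (φ e) = α (π e)`. [cite: Carlson1980, §2(b)] -/
@[simp]
theorem proj_mid_apply (m : Morphism E E') (e : VE) :
    E'.proj.toLinearMap (m.mid.toLinearMap e) = m.right.toLinearMap (E.proj.toLinearMap e) :=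
  LinearMap.congr_fun m.proj_mid e

/-- `φ_ℂ (i_ℂ y) = i'_ℂ (β_ℂ y)`. [cite: Carlson1980, §2(b)] -/
theorem midC_incC_apply (m : Morphism E E') (y : ℂ ⊗[ℚ] VB) :
    m.mid.toLinearMap.baseChange ℂ (E.incC y) = E'.incC (m.left.toLinearMap.baseChange ℂ y) := by
  rw [← LinearMap.comp_apply, ← LinearMap.baseChange_comp, m.mid_inc, LinearMap.baseChange_comp,
    LinearMap.comp_apply]

/-- `i'_ℂ (β_ℂ y) = φ_ℂ (i_ℂ y)`. [cite: Carlson1980, §2(b)] -/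
theorem incC_leftC_apply (m : Morphism E E') (y : ℂ ⊗[ℚ] VB) :
    E'.incC (m.left.toLinearMap.baseChange ℂ y) = m.mid.toLinearMap.baseChange ℂ (E.incC y) :=
  (m.midC_incC_apply y).symm

/-- `π'_ℂ (φ_ℂ z) = α_ℂ (π_ℂ z)`. [cite: Carlson1980, §2(b)] -/
theorem projC_midC_apply (m : Morphism E E') (z : ℂ ⊗[ℚ] VE) :
    E'.projC (m.mid.toLinearMap.baseChange ℂ z) = m.right.toLinearMap.baseChange ℂ (E.projC z) := by
  rw [← LinearMap.comp_apply, ← LinearMap.baseChange_comp, m.proj_mid, LinearMap.baseChange_comp,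
    LinearMap.comp_apply]

/-- The identity morphism of an extension. [cite: Carlson1980, §2(b)] -/
protected def id (E : Extension A B VE) : Morphism E E where
  left := Hom.id B
  mid := Hom.id E.mhs
  right := Hom.id A
  mid_inc := by rw [Hom.id_toLinearMap, Hom.id_toLinearMap, LinearMap.id_comp, LinearMap.comp_id]
  proj_mid := by rw [Hom.id_toLinearMap, Hom.id_toLinearMap, LinearMap.id_comp, LinearMap.comp_id]

/-- Composition of morphisms of extensions. [cite: Carlson1980, §2(b)] -/
protected def comp {VA'' VB'' VE'' : Type*} [AddCommGroup VA''] [Module ℚ VA''] [AddCommGroup VB'']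
    [Module ℚ VB''] [AddCommGroup VE''] [Module ℚ VE''] {A'' : MixedHodgeStructure VA''}
    {B'' : MixedHodgeStructure VB''} {E'' : Extension A'' B'' VE''} (m' : Morphism E' E'')
    (m : Morphism E E') : Morphism E E'' where
  left := m'.left.comp m.left
  mid := m'.mid.comp m.mid
  right := m'.right.comp m.right
  mid_inc := by
    rw [Hom.comp_toLinearMap, Hom.comp_toLinearMap, LinearMap.comp_assoc, m.mid_inc,
      ← LinearMap.comp_assoc, m'.mid_inc, LinearMap.comp_assoc]
  proj_mid := by
    rw [Hom.comp_toLinearMap, Hom.comp_toLinearMap, ← LinearMap.comp_assoc, m'.proj_mid,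
      LinearMap.comp_assoc, m.proj_mid, ← LinearMap.comp_assoc]

/-- The underlying maps of a composite (by `rfl`). [cite: Carlson1980, §2(b)] -/
@[simp]
theorem comp_mid_toLinearMap {VA'' VB'' VE'' : Type*} [AddCommGroup VA''] [Module ℚ VA'']
    [AddCommGroup VB''] [Module ℚ VB''] [AddCommGroup VE''] [Module ℚ VE'']
    {A'' : MixedHodgeStructure VA''} {B'' : MixedHodgeStructure VB''} {E'' : Extension A'' B'' VE''}
    (m' : Morphism E' E'') (m : Morphism E E') :
    (m'.comp m).mid.toLinearMap = m'.mid.toLinearMap ∘ₗ m.mid.toLinearMap := rfl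

end Morphism

/-- A congruence is a morphism of extensions over `(id_B, ·, id_A)`. [cite: Carlson1980, §2(b)] -/
def Congruence.toMorphism {E : Extension A B VE} {E' : Extension A B VE'} (c : Congruence E E') :
    Morphism E E' where
  left := Hom.id B
  mid := c.hom
  right := Hom.id A
  mid_inc := by rw [c.hom_inc, Hom.id_toLinearMap, LinearMap.comp_id]
  proj_mid := by rw [c.proj_hom, Hom.id_toLinearMap, LinearMap.id_comp]

/-- The middle map of `c.toMorphism` is `c.hom` (by `rfl`). [cite: Carlson1980, §2(b)] -/
@[simp]
theorem Congruence.toMorphism_mid {E : Extension A B VE} {E' : Extension A B VE'}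
    (c : Congruence E E') : c.toMorphism.mid = c.hom := rfl

namespace Morphism

variable {E : Extension A B VE} {E' : Extension A' B' VE'}

/-! ### The short five lemma: morphisms over `(id, ·, id)` are congruences -/

/-- **Short five lemma, injectivity** (Mac Lane, *Homology*, Ch. I Lemma 3.1 (ii)): if `β` and `α`
are injective, so is `φ`. [cite: MacLane1963Homology, Ch. I Lemma 3.1 (ii)] -/
theorem injective_mid (m : Morphism E E') (hl : Function.Injective m.left.toLinearMap)
    (hr : Function.Injective m.right.toLinearMap) : Function.Injective m.mid.toLinearMap := by
  refine (injective_iff_map_eq_zero _).2 fun e he => ?_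
  have h1 : E.proj.toLinearMap e = 0 := by
    apply hr
    rw [map_zero, ← proj_mid_apply, he, map_zero]
  obtain ⟨b, rfl⟩ := (E.exact e).1 h1
  have h2 : m.left.toLinearMap b = 0 := by
    apply E'.injective_inc
    rw [map_zero, ← mid_inc_apply, he]
  rw [hl (h2.trans (map_zero _).symm), map_zero]

/-- **Short five lemma, surjectivity** (Mac Lane, *Homology*, Ch. I Lemma 3.1 (iii)): if `β` and `α`
are surjective, so is `φ`. [cite: MacLane1963Homology, Ch. I Lemma 3.1 (iii)] -/
theorem surjective_mid (m : Morphism E E') (hl : Function.Surjective m.left.toLinearMap)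
    (hr : Function.Surjective m.right.toLinearMap) : Function.Surjective m.mid.toLinearMap := by
  intro e'
  obtain ⟨a, ha⟩ := hr (E'.proj.toLinearMap e')
  obtain ⟨e₀, rfl⟩ := E.surjective_proj a
  have h1 : E'.proj.toLinearMap (e' - m.mid.toLinearMap e₀) = 0 := by
    rw [map_sub, proj_mid_apply, ha, sub_self]
  obtain ⟨b', hb'⟩ := (E'.exact _).1 h1
  obtain ⟨b, rfl⟩ := hl b'
  refine ⟨e₀ + E.inc.toLinearMap b, ?_⟩
  rw [map_add, mid_inc_apply, hb', add_sub_cancel]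

/-- **Short five lemma** (Mac Lane, *Homology*, Ch. I Lemma 3.1 (i)): if `β` and `α` are bijective,
so is `φ`. [cite: MacLane1963Homology, Ch. I Lemma 3.1 (i)] -/
theorem bijective_mid (m : Morphism E E') (hl : Function.Bijective m.left.toLinearMap)
    (hr : Function.Bijective m.right.toLinearMap) : Function.Bijective m.mid.toLinearMap :=
  ⟨m.injective_mid hl.1 hr.1, m.surjective_mid hl.2 hr.2⟩

/-- A morphism of extensions over `(id_B, ·, id_A)` is bijective on the middle terms (Mac Lane,
*Homology*, Ch. III §1: "the short Five Lemma shows that the middle homomorphism `β` is an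
isomorphism"). [cite: MacLane1963Homology, Ch. III §1] -/
theorem bijective_mid_of_eq_id {E' : Extension A B VE'} (m : Morphism E E') (hl : m.left = Hom.id B)
    (hr : m.right = Hom.id A) : Function.Bijective m.mid.toLinearMap :=
  m.bijective_mid (by rw [hl, Hom.id_toLinearMap]; exact Function.bijective_id)
    (by rw [hr, Hom.id_toLinearMap]; exact Function.bijective_id)

/-- **A morphism of extensions over `(id_B, ·, id_A)` is a congruence** (Carlson 1980, §2(b): "An
isomorphism for which `α` and `β` are each the identity is called a *congruence*" — by the short
five lemma and `Hom.inverse` every such morphism is an isomorphism). [cite: Carlson1980, §2(b)] -/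
def toCongruence {E' : Extension A B VE'} (m : Morphism E E') (hl : m.left = Hom.id B)
    (hr : m.right = Hom.id A) : Congruence E E' where
  hom := m.mid
  inv := m.mid.inverse (m.bijective_mid_of_eq_id hl hr)
  hom_inv := congrArg Hom.toLinearMap (m.mid.comp_inverse (m.bijective_mid_of_eq_id hl hr))
  inv_hom := congrArg Hom.toLinearMap (m.mid.inverse_comp (m.bijective_mid_of_eq_id hl hr))
  hom_inc := by rw [m.mid_inc, hl, Hom.id_toLinearMap, LinearMap.comp_id]
  proj_hom := by rw [m.proj_mid, hr, Hom.id_toLinearMap, LinearMap.id_comp]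

/-- The congruence attached to a morphism over `(id, ·, id)` has `hom = mid` (by `rfl`). [cite: Carlson1980, §2(b)] -/
@[simp]
theorem toCongruence_hom {E' : Extension A B VE'} (m : Morphism E E') (hl : m.left = Hom.id B)
    (hr : m.right = Hom.id A) : (m.toCongruence hl hr).hom = m.mid := rfl

/-! ### The class along a morphism of extensions: `β_* [E] = α^* [E']` -/

/-- Two Hodge lifts of `α_ℂ` into `E'_ℂ` — `φ_ℂ ∘ s_F` and `s'_F ∘ α_ℂ` — differ by `i'_ℂ` of an
element of `F⁰Hom(A, B')` (the difference dies under `π'_ℂ`, so lies in `i'_ℂ(B'_ℂ) = ker π'_ℂ`, and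
respects `F` by the strictness of `i'`; Carlson 1980, §2(d), proof of Lemma 4). [cite: Carlson1980, §2(d) Lemma 4] -/
theorem exists_mem_homF_sub (m : Morphism E E') (sF : E.HodgeSection) (sF' : E'.HodgeSection) :
    ∃ h ∈ homF A B' 0, E'.incC ∘ₗ h =
      m.mid.toLinearMap.baseChange ℂ ∘ₗ sF.toLinearMap -
        sF'.toLinearMap ∘ₗ m.right.toLinearMap.baseChange ℂ := by
  have hle : LinearMap.range (m.mid.toLinearMap.baseChange ℂ ∘ₗ sF.toLinearMap -
      sF'.toLinearMap ∘ₗ m.right.toLinearMap.baseChange ℂ) ≤ LinearMap.range E'.incC := by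
    rw [E'.range_incC]
    rintro _ ⟨x, rfl⟩
    simp only [LinearMap.mem_ker, LinearMap.sub_apply, map_sub, LinearMap.comp_apply,
      projC_midC_apply, HodgeSection.projC_apply, sub_self]
  refine ⟨liftOfRangeLE E'.incC E'.injective_incC _ hle, ?_, comp_liftOfRangeLE _ _ _ _⟩
  rw [mem_homF_zero_iff]
  rintro p _ ⟨x, hx, rfl⟩
  refine E'.mem_F_of_incC_mem ?_
  rw [apply_liftOfRangeLE, LinearMap.sub_apply, LinearMap.comp_apply, LinearMap.comp_apply]
  exact (E'.mhs.F p).sub_mem (m.mid.map_F_le p ⟨_, sF.map_F_le p ⟨x, hx, rfl⟩, rfl⟩)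
    (sF'.map_F_le p ⟨_, m.right.map_F_le p ⟨x, hx, rfl⟩, rfl⟩)

/-- Two rational lifts of `α` into `E'` — `φ ∘ s_ℚ` and `s'_ℚ ∘ α` — differ by `i'` of a rational map
`A → B'` (the lattice half of Carlson's Lemma 4 argument, run through `φ`). [cite: Carlson1980, §2(d) Lemma 4] -/
theorem exists_rat_sub (m : Morphism E E') (sQ : E.RatSection) (sQ' : E'.RatSection) :
    ∃ r : VA →ₗ[ℚ] VB', E'.inc.toLinearMap ∘ₗ r =
      m.mid.toLinearMap ∘ₗ sQ.toLinearMap - sQ'.toLinearMap ∘ₗ m.right.toLinearMap := by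
  have hle : LinearMap.range (m.mid.toLinearMap ∘ₗ sQ.toLinearMap -
      sQ'.toLinearMap ∘ₗ m.right.toLinearMap) ≤ LinearMap.range E'.inc.toLinearMap := by
    rw [E'.range_inc]
    rintro _ ⟨x, rfl⟩
    simp only [LinearMap.mem_ker, LinearMap.sub_apply, map_sub, LinearMap.comp_apply,
      proj_mid_apply, RatSection.proj_apply, sub_self]
  exact ⟨liftOfRangeLE _ E'.injective_inc _ hle, comp_liftOfRangeLE _ _ _ _⟩

/-- The representing homomorphisms along a morphism of extensions:
`β_ℂ ∘ ψ(E) - ψ(E') ∘ α_ℂ ∈ F⁰Hom(A, B') + Hom_ℚ(A, B')` for any sections. [cite: Carlson1980, §2(d) Lemma 4] -/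
theorem sub_mem_JHomSub (m : Morphism E E') (sF : E.HodgeSection) (sQ : E.RatSection)
    (sF' : E'.HodgeSection) (sQ' : E'.RatSection) :
    m.left.toLinearMap.baseChange ℂ ∘ₗ E.reprHom sF sQ -
      E'.reprHom sF' sQ' ∘ₗ m.right.toLinearMap.baseChange ℂ ∈ JHomSub A B' := by
  obtain ⟨h, hh, hhe⟩ := m.exists_mem_homF_sub sF sF'
  obtain ⟨r, hre⟩ := m.exists_rat_sub sQ sQ'
  have key : m.left.toLinearMap.baseChange ℂ ∘ₗ E.reprHom sF sQ -
      E'.reprHom sF' sQ' ∘ₗ m.right.toLinearMap.baseChange ℂ = h - r.baseChange ℂ := by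
    refine LinearMap.ext fun x => E'.injective_incC ?_
    have h1 := LinearMap.congr_fun hhe x
    have h2 := LinearMap.congr_fun (congrArg (LinearMap.baseChange ℂ) hre) x
    simp only [LinearMap.comp_apply, LinearMap.sub_apply, LinearMap.baseChange_comp,
      LinearMap.baseChange_sub] at h1 h2
    simp only [LinearMap.sub_apply, LinearMap.comp_apply, map_sub, h1, h2, incC_leftC_apply,
      incC_reprHom]
    abel
  rw [key]
  exact Submodule.sub_mem _ (Submodule.mem_sup_left hh)
    (Submodule.mem_sup_right (baseChange_mem_ratHom r))

/-- **Functoriality of Carlson's class along a morphism of extensions** (Carlson 1980, Prop. 1 and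
Prop. 2, "canonical and functorial"): for `(β, φ, α) : E → E'`,
`β_* [E] = α^* [E']` in `J⁰Hom(A, B')` — the image under `Ext ≅ J⁰Hom` of Mac Lane, *Homology*,
Ch. III Prop. 1.8: "Any morphism `(α, β, γ) : E → E'` of extensions implies a congruence
`αE ≡ E'γ`". No separation hypothesis. [cite: Carlson1980, §2(b) Prop. 2] [cite: MacLane1963Homology, Ch. III Prop. 1.8] -/
theorem postcomp_cls_eq_precomp_cls (m : Morphism E E') :
    JHom.postcomp A m.left E.cls = JHom.precomp A' B' m.right E'.cls := by
  obtain ⟨sF⟩ := E.nonempty_hodgeSection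
  obtain ⟨sQ⟩ := E.nonempty_ratSection
  obtain ⟨sF'⟩ := E'.nonempty_hodgeSection
  obtain ⟨sQ'⟩ := E'.nonempty_ratSection
  rw [E.cls_eq_extClass sF sQ, E'.cls_eq_extClass sF' sQ', extClass, extClass, JHom.postcomp_mk,
    JHom.precomp_mk, JHom.mk_eq_mk_iff]
  exact m.sub_mem_JHomSub sF sQ sF' sQ'

/-- **Push-out formula**: along a morphism `(β, φ, id_A) : E → E'` of extensions of the same `A`,
`[E'] = β_* [E]`. [cite: Carlson1980, §2(b) Prop. 2] -/
theorem cls_eq_postcomp_cls {E' : Extension A B' VE'} (m : Morphism E E')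
    (hr : m.right = Hom.id A) : E'.cls = JHom.postcomp A m.left E.cls := by
  rw [m.postcomp_cls_eq_precomp_cls, hr, JHom.precomp_id, LinearMap.id_apply]

/-- **Pull-back formula**: along a morphism `(id_B, φ, α) : E → E'` of extensions by the same `B`,
`[E] = α^* [E']`. [cite: Carlson1980, §2(b) Prop. 2] -/
theorem cls_eq_precomp_cls {E' : Extension A' B VE'} (m : Morphism E E')
    (hl : m.left = Hom.id B) : E.cls = JHom.precomp A' B m.right E'.cls := by
  rw [← m.postcomp_cls_eq_precomp_cls, hl, JHom.postcomp_id, LinearMap.id_apply]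

/-- A morphism of extensions over `(id_B, ·, id_A)` preserves the class (cf. `cls_eq_of_congruence`;
here without first inverting `φ`). [cite: Carlson1980, §2(b) Prop. 2] -/
theorem cls_eq_cls {E' : Extension A B VE'} (m : Morphism E E') (hl : m.left = Hom.id B)
    (hr : m.right = Hom.id A) : E.cls = E'.cls := by
  rw [m.cls_eq_precomp_cls hl, hr, JHom.precomp_id, LinearMap.id_apply]

end Morphism

end Extension

end MixedHodgeStructure

end Literature.AlgebraicGeometry.Motives

end
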